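import Literature.Probability.RandomPlanarGeometry.SLEBubblesThm65Kappa
import Literature.Probability.RandomPlanarGeometry.SLEImageLocalisationPaths
import Literature.Probability.RandomPlanarGeometry.SLEImageLocalisationCell
import Literature.Probability.Process.MartingaleProblemTilting
import Literature.Probability.Process.LevyCharacterisationCore
import HarnessLib

/-!
# The tilted [LSW] Theorem 6.5 (line `boundary-area-law`, RS5b): tilting by the terminal value of a bounded martingale

Line `boundary-area-law` of the crux `SubseqIdentification` (stmt-CriticalPhenomena-0783), restriction
reshape (lead c4, r-c4-3), stub RS5b `stub_thm65Tilted` (the Girsanov reading of G. F. Lawler,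
O. Schramm, W. Werner, *Conformal restriction: the chordal case*, J. Amer. Math. Soc. 16 (2003),
Prop. 5.3 with §5 (5.1)–(5.3)). Milestone (T3) of the plan `RS5b-PLAN.md`: **the change of measure,
without stochastic integrals.**

Abstract part (any filtered probability space `(Ω, 𝓕, P)`, index `ℝ≥0`). Let `Y` be a bounded
`𝓕`-martingale whose values along `ℕ` converge a.s. to `Y_∞ ≥ 0`, and let `Q = Y_∞ · P`
(`Measure.withDensity`). Then

* `setIntegral_terminal_mul_eq` — **Bayes' formula for the density process**:
  `∫_S Y_∞ Z dP = ∫_S Y_t Z dP` for `S ∈ 𝓕_t` and bounded `𝓕_t`-measurable `Z` (martingale property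
  of `Y` between `t` and `n ≥ t`, then dominated convergence `n → ∞`; the martingale need not be
  closed in `L¹` by hypothesis — boundedness does it);
* `isAEMartingale_withDensity_of_mul` — **if `X` is bounded, strongly adapted and `X · Y` is a
  `P`-martingale, then `X` is a `Q`-martingale** (a.e. form `IsAEMartingale`, set-integral
  characterisation): the elementary half of Girsanov's theorem (Revuz–Yor (1999), Ch. VIII,
  Prop. (1.2)–(1.3));
* `hasMartingaleClock_withDensity` — hence, if also `(X² − c) · Y` is a `P`-martingale for a clock
  `c`, `X` carries the martingale clock `c` under `Q` (`Process.HasMartingaleClock`, the input format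
  of the tree's Dambis–Dubins–Schwarz time change `HasMartingaleClock.timeChange` and of
  `isBrownianReal_concat`, both stated for an arbitrary probability measure).

SLE part, (T3) proper: `hasMartingaleClock_imgMartK_tilted` — for `0 < κ ≤ 8/3`, a nonempty
`A ∈ 𝒬*` with restriction data `(Φ, d)`, a compensated restriction martingale `Y` of [LSW]
Prop. 5.3 (`IsRestrictionMartingaleK κ α_κ λ_κ A (LpK κ A) Y`) and a localisation level `n`: IF the
localised image driving function `Mⁿ = imgMartK κ hA hne n` (`W̃ = h_t(W_t)` stopped at
`imgLocTimeK n`, `SLEImageLocalisation`) satisfies the two `P`-martingale identities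
`Mⁿ · Y` and `((Mⁿ)² − κ · imgClockK n) · Y` — this is (T2), [LSW] (5.1)–(5.3) + Prop. 5.3 + the
covariation `d⟨W̃, Y⟩ = Y α κ h″ dt`, i.e. the cancellation `κα + κ/2 − 3 = 0` — THEN under the
normalised tilted probability `Q̄_A = (Y_∞ / Φ_A′(0)^α) · P` the process `Mⁿ/√κ` carries the
martingale clock `imgClockK n`: the localised image driver of SLE_κ is, under `Q̄_A`, a continuous
martingale with bracket `κ ∫ h_s′(W_s)² ds`, ready for the DDS/Lévy step (T4) exactly as in the
tree's `exists_sle_image_brownian` (the case `κ = 6`, `Y ≡ 1`).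

References: [LSW] Prop. 5.3, §5; D. Revuz, M. Yor, *Continuous martingales and Brownian motion*
(1999), Ch. VIII §1; G. F. Lawler, *Conformally invariant processes in the plane* (2005), Prop. 6.19.
No named fact is used.
-/

noncomputable section

open MeasureTheory Filter Topology Set
open scoped NNReal ENNReal
open Literature.Probability.RandomPlanarGeometry
open Literature.Probability.Process (preWienerMeasure HasMartingaleClock IsAEMartingale)
open UpperHalfPlane (upperHalfPlaneSet)

namespace Summit.CriticalPhenomena.SAWScalingLimit.Theorems.SubseqIdentification.BoundaryAreaLaw

/-! ### Tilting by the terminal value of a bounded martingale (abstract) -/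

section Abstract

variable {Ω : Type*} {mΩ : MeasurableSpace Ω} {P : Measure Ω}
  {𝓕 : Filtration ℝ≥0 mΩ} {Y : ℝ≥0 → Ω → ℝ} {Yi : Ω → ℝ} {C : ℝ}

/-- An a.e. limit of a bounded sequence of functions is bounded a.e. by the same constant. [folklore] -/
theorem ae_abs_le_of_tendsto (hYb : ∀ t ω, |Y t ω| ≤ C)
    (hlim : ∀ᵐ ω ∂P, Tendsto (fun n : ℕ ↦ Y n ω) atTop (𝓝 (Yi ω))) : ∀ᵐ ω ∂P, |Yi ω| ≤ C := by
  filter_upwards [hlim] with ω hω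
  exact le_of_tendsto' ((continuous_abs.tendsto _).comp hω) fun n ↦ hYb n ω

/-- **Bayes' formula for the density process.** For a bounded `𝓕`-martingale `Y` with a.e. limit
`Y_∞` along `ℕ`, `∫_S Y_∞ Z dP = ∫_S Y_t Z dP` for `S ∈ 𝓕_t` and every bounded `𝓕_t`-measurable `Z`:
for `n ≥ t` the martingale property gives `∫_S Y_n Z = ∫_S Y_t Z`, and `n → ∞` by dominated
convergence. [cite: RevuzYor1999, Ch. VIII Prop. (1.2)] -/
theorem setIntegral_terminal_mul_eq [IsProbabilityMeasure P] (hY : Martingale Y 𝓕 P) (hYb : ∀ t ω, |Y t ω| ≤ C)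
    (hlim : ∀ᵐ ω ∂P, Tendsto (fun n : ℕ ↦ Y n ω) atTop (𝓝 (Yi ω)))
    {t : ℝ≥0} {Z : Ω → ℝ} (hZ : Measurable[𝓕 t] Z) {CZ : ℝ} (hZb : ∀ ω, |Z ω| ≤ CZ)
    {S : Set Ω} (hS : MeasurableSet[𝓕 t] S) :
    ∫ ω in S, Yi ω * Z ω ∂P = ∫ ω in S, Y t ω * Z ω ∂P := by
  have hSm : MeasurableSet S := 𝓕.le t S hS
  have hZm : Measurable Z := hZ.mono (𝓕.le t) le_rfl
  -- for `n ≥ t`, `∫_S Y_n Z = ∫_S Y_t Z`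
  have hconst : ∀ᶠ n : ℕ in atTop, ∫ ω in S, Y n ω * Z ω ∂P = ∫ ω in S, Y t ω * Z ω ∂P := by
    obtain ⟨N, hN⟩ := exists_nat_ge (t : ℝ)
    filter_upwards [eventually_ge_atTop N] with n hn
    have htn : t ≤ (n : ℝ≥0) := by
      have : (t : ℝ) ≤ n := hN.trans (by exact_mod_cast hn)
      exact_mod_cast this
    exact Literature.Probability.Process.setIntegral_mul_eq_of_martingale hY le_rfl htn hS hZ hZb
  -- dominated convergence along `ℕ`
  have hmeas : ∀ n : ℕ, AEStronglyMeasurable (fun ω ↦ Y n ω * Z ω) (P.restrict S) := fun n ↦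
    (((hY.stronglyMeasurable n).mono (𝓕.le n)).measurable.mul hZm).aestronglyMeasurable
  have hbound : ∀ n : ℕ, ∀ᵐ ω ∂P.restrict S, ‖Y n ω * Z ω‖ ≤ C * CZ := fun n ↦
    Eventually.of_forall fun ω ↦ by
      rw [Real.norm_eq_abs, abs_mul]
      exact mul_le_mul (hYb n ω) (hZb ω) (abs_nonneg _) ((abs_nonneg _).trans (hYb n ω))
  have hlim' : ∀ᵐ ω ∂P.restrict S, Tendsto (fun n : ℕ ↦ Y n ω * Z ω) atTop (𝓝 (Yi ω * Z ω)) :=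
    ae_restrict_of_ae (hlim.mono fun ω hω ↦ hω.mul_const _)
  have hDCT := tendsto_integral_of_dominated_convergence (fun _ ↦ C * CZ) hmeas (integrable_const _) hbound hlim'
  exact tendsto_nhds_unique hDCT (tendsto_const_nhds.congr' (EventuallyEq.symm hconst))

/-- The tilted measure `Y_∞ · P` is finite. [folklore] -/
theorem isFiniteMeasure_withDensity_terminal [IsProbabilityMeasure P] (hYb : ∀ t ω, |Y t ω| ≤ C)
    (hlim : ∀ᵐ ω ∂P, Tendsto (fun n : ℕ ↦ Y n ω) atTop (𝓝 (Yi ω))) (hYim : Measurable Yi) :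
    IsFiniteMeasure (P.withDensity fun ω ↦ ENNReal.ofReal (Yi ω)) := by
  refine isFiniteMeasure_withDensity_ofReal ?_
  have hint : Integrable Yi P := (integrable_const C).mono' hYim.aestronglyMeasurable
    ((ae_abs_le_of_tendsto hYb hlim).mono fun ω hω ↦ by rw [Real.norm_eq_abs]; exact hω)
  exact hint.hasFiniteIntegral

/-- Set integrals under the tilted measure: `∫_S g dQ = ∫_S Y_∞ g dP` (`Y_∞ ≥ 0` measurable). [folklore] -/
theorem setIntegral_withDensity_terminal (hYim : Measurable Yi) (hYi0 : ∀ ω, 0 ≤ Yi ω) (g : Ω → ℝ)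
    {S : Set Ω} (hS : MeasurableSet S) :
    ∫ ω in S, g ω ∂(P.withDensity fun ω ↦ ENNReal.ofReal (Yi ω)) = ∫ ω in S, Yi ω * g ω ∂P := by
  have hdens : (fun ω ↦ ENNReal.ofReal (Yi ω)) = fun ω ↦ (((Yi ω).toNNReal : ℝ≥0) : ℝ≥0∞) := rfl
  rw [hdens, setIntegral_withDensity_eq_setIntegral_smul hYim.real_toNNReal _ hS]
  refine setIntegral_congr_fun hS fun ω _ ↦ ?_
  rw [NNReal.smul_def, smul_eq_mul, Real.coe_toNNReal _ (hYi0 ω)]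

/-- **The elementary half of Girsanov's theorem.** Let `Y` be a bounded `𝓕`-martingale with a.e.
limit `Y_∞ ≥ 0` along `ℕ` and `Q = Y_∞ · P`. If `X` is strongly adapted, bounded at each time, and
`X · Y` is a `P`-martingale, then `X` is a `Q`-martingale (a.e. form): for `s ≤ t`, `S ∈ 𝓕_s`,
`∫_S X_t dQ = ∫_S Y_t X_t dP = ∫_S Y_s X_s dP = ∫_S X_s dQ`. [cite: RevuzYor1999, Ch. VIII Prop. (1.3)] -/
theorem isAEMartingale_withDensity_of_mul [IsProbabilityMeasure P] (hY : Martingale Y 𝓕 P) (hYb : ∀ t ω, |Y t ω| ≤ C)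
    (hlim : ∀ᵐ ω ∂P, Tendsto (fun n : ℕ ↦ Y n ω) atTop (𝓝 (Yi ω))) (hYim : Measurable Yi)
    (hYi0 : ∀ ω, 0 ≤ Yi ω) {X : ℝ≥0 → Ω → ℝ} (hX : StronglyAdapted 𝓕 X) {CX : ℝ≥0 → ℝ}
    (hXb : ∀ t ω, |X t ω| ≤ CX t) (hXY : Martingale (fun t ω ↦ X t ω * Y t ω) 𝓕 P) :
    IsAEMartingale X 𝓕 (P.withDensity fun ω ↦ ENNReal.ofReal (Yi ω)) := by
  haveI := isFiniteMeasure_withDensity_terminal hYb hlim hYim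
  set Q : Measure Ω := P.withDensity fun ω ↦ ENNReal.ofReal (Yi ω) with hQ
  have hXm : ∀ t, Measurable[𝓕 t] (X t) := fun t ↦ (hX t).measurable
  have hmeas : ∀ t, AEStronglyMeasurable[𝓕 t] (X t) Q := fun t ↦ (hX t).aestronglyMeasurable
  have hint : ∀ t, Integrable (X t) Q := fun t ↦
    (integrable_const (CX t)).mono' ((hX t).mono (𝓕.le t)).aestronglyMeasurable
      (Eventually.of_forall fun ω ↦ by rw [Real.norm_eq_abs]; exact hXb t ω)
  refine IsAEMartingale.of_setIntegral_eq hmeas hint fun s t hst S hS ↦ ?_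
  have hSm : MeasurableSet S := 𝓕.le s S hS
  have hSt : MeasurableSet[𝓕 t] S := 𝓕.mono hst S hS
  rw [setIntegral_withDensity_terminal hYim hYi0 _ hSm, setIntegral_withDensity_terminal hYim hYi0 _ hSm,
    setIntegral_terminal_mul_eq hY hYb hlim (hXm s) (hXb s) hS,
    setIntegral_terminal_mul_eq hY hYb hlim (hXm t) (hXb t) hSt]
  have h1 := hXY.setIntegral_eq hst hS
  have e1 : (fun ω ↦ Y s ω * X s ω) = fun ω ↦ X s ω * Y s ω := by funext ω; ring
  have e2 : (fun ω ↦ Y t ω * X t ω) = fun ω ↦ X t ω * Y t ω := by funext ω; ring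
  rw [e1, e2]
  exact h1

/-- **A martingale clock under the tilted measure.** In the setting of
`isAEMartingale_withDensity_of_mul`, if `|X| ≤ N`, `c` is an adapted clock (`c_0 = 0`, nondecreasing,
`c_t − c_s ≤ t − s`) and both `X · Y` and `(X² − c) · Y` are `P`-martingales, then `X` carries the
martingale clock `c` under `Q = Y_∞ · P`. [cite: RevuzYor1999, Ch. VIII Prop. (1.3)] -/
theorem hasMartingaleClock_withDensity [IsProbabilityMeasure P] (hY : Martingale Y 𝓕 P) (hYb : ∀ t ω, |Y t ω| ≤ C)
    (hlim : ∀ᵐ ω ∂P, Tendsto (fun n : ℕ ↦ Y n ω) atTop (𝓝 (Yi ω))) (hYim : Measurable Yi)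
    (hYi0 : ∀ ω, 0 ≤ Yi ω) {X c : ℝ≥0 → Ω → ℝ} (hX : StronglyAdapted 𝓕 X) (hc : Adapted 𝓕 c) {N : ℝ}
    (hXb : ∀ t ω, |X t ω| ≤ N) (hc0 : ∀ ω, c 0 ω = 0) (hcmono : ∀ ω ⦃s t : ℝ≥0⦄, s ≤ t → c s ω ≤ c t ω)
    (hcsub : ∀ ω ⦃s t : ℝ≥0⦄, s ≤ t → c t ω - c s ω ≤ (t : ℝ) - s)
    (hXY : Martingale (fun t ω ↦ X t ω * Y t ω) 𝓕 P)
    (hX2Y : Martingale (fun t ω ↦ (X t ω ^ 2 - c t ω) * Y t ω) 𝓕 P) :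
    HasMartingaleClock X c 𝓕 (P.withDensity fun ω ↦ ENNReal.ofReal (Yi ω)) N := by
  have hcle : ∀ t ω, |c t ω| ≤ t := fun t ω ↦ by
    have h0 : 0 ≤ c t ω := by have := hcmono ω (show (0 : ℝ≥0) ≤ t from bot_le); rwa [hc0] at this
    have h1 : c t ω ≤ t := by have := hcsub ω (show (0 : ℝ≥0) ≤ t from bot_le); rw [hc0] at this; simpa using this
    rw [abs_of_nonneg h0]; exact h1
  have hX2 : StronglyAdapted 𝓕 fun t ω ↦ X t ω ^ 2 - c t ω := fun t ↦
    ((hX t).pow 2).sub (hc t).stronglyMeasurable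
  have hX2b : ∀ t ω, |X t ω ^ 2 - c t ω| ≤ N ^ 2 + t := fun t ω ↦ by
    refine (abs_sub _ _).trans (add_le_add ?_ (hcle t ω))
    rw [abs_pow]; exact pow_le_pow_left₀ (abs_nonneg _) (hXb t ω) 2
  exact
    { isAEMartingale := isAEMartingale_withDensity_of_mul hY hYb hlim hYim hYi0 hX (fun t ω ↦ hXb t ω) hXY
      isAEMartingale_sq_sub := isAEMartingale_withDensity_of_mul hY hYb hlim hYim hYi0 hX2 hX2b hX2Y
      clock_zero := hc0
      clock_mono := hcmono
      clock_sub_le := hcsub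
      abs_le := Eventually.of_forall fun ω t ↦ hXb t ω }

/-- The tilted measure is a probability measure when `∫⁻ Y_∞ dP = 1`. [folklore] -/
theorem isProbabilityMeasure_withDensity_of_lintegral_eq_one
    (h : ∫⁻ ω, ENNReal.ofReal (Yi ω) ∂P = 1) :
    IsProbabilityMeasure (P.withDensity fun ω ↦ ENNReal.ofReal (Yi ω)) :=
  ⟨by rw [withDensity_apply _ MeasurableSet.univ, Measure.restrict_univ, h]⟩

end Abstract

/-! ### (T3): the localised image driver of SLE_κ under the tilted probability -/

section SLE

open Loewner

variable {κ : ℝ≥0} {A : Set ℂ} {Y : ℝ≥0 → (ℝ≥0 → ℝ) → ℝ}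

/-- A.s. `Y_n → Y_∞` along `ℕ` for a compensated restriction martingale of a `*`-hull (limit on
`{T = ∞}` by specification, constant from `T` on otherwise). [folklore] -/
theorem ae_tendsto_nat_Yinf {α lam : ℝ} {L : ℝ≥0 → (ℝ≥0 → ℝ) → ℝ≥0∞} (hA : IsStarHull A)
    (hY : IsRestrictionMartingaleK κ α lam A L Y) :
    ∀ᵐ ω ∂preWienerMeasure, Tendsto (fun n : ℕ ↦ Y n ω) atTop (𝓝 (Yinf Y ω)) := by
  filter_upwards [hY.ae_exists_tendsto, hY.ae_frozen_const hA] with ω hlim hconst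
  by_cases hT : firstHit (sleTrace κ ω) A = ⊤
  · obtain ⟨c, hc⟩ := hlim hT
    have h1 : Tendsto (fun n : ℕ ↦ Y n ω) atTop (𝓝 c) := hc.comp tendsto_natCast_atTop_atTop
    have h2 : Yinf Y ω = c := h1.limsup_eq
    rwa [h2]
  · obtain ⟨τ, hτ⟩ := WithTop.ne_top_iff_exists.1 hT
    have hev : ∀ᶠ n : ℕ in atTop, Y n ω = Y τ ω := by
      obtain ⟨N, hN⟩ := exists_nat_ge (τ : ℝ)
      filter_upwards [eventually_ge_atTop N] with n hn
      refine hconst τ hτ.symm n ?_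
      have : (τ : ℝ) ≤ n := hN.trans (by exact_mod_cast hn)
      exact_mod_cast this
    have h1 : Tendsto (fun n : ℕ ↦ Y n ω) atTop (𝓝 (Y τ ω)) := tendsto_const_nhds.congr' (EventuallyEq.symm hev)
    have h2 : Yinf Y ω = Y τ ω := h1.limsup_eq
    rwa [h2]

/-- **(T3) — the localised image driving function of SLE_κ carries its capacity clock under the
tilted probability.** Let `0 < κ ≤ 8/3`, `A ∈ 𝒬*` nonempty with restriction data `(Φ, d)`, `Y` a
compensated restriction martingale of [LSW] Prop. 5.3 for `A` (exponents `α_κ, λ_κ`, compensator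
`LpK κ A`), and `n` a localisation level; write `Mⁿ = imgMartK κ hA hne n` (the image driving function
`W̃ = h_t(W_t)` stopped at `imgLocTimeK n`) and `cⁿ = imgClockK κ hA hne n` (`∫₀ᵗ h_s′(W_s)² ds`, frozen).
IF `Mⁿ · Y` and `((Mⁿ)² − κ cⁿ) · Y` are `P`-martingales ((T2): [LSW] (5.1)–(5.3), Prop. 5.3 and the
cancellation `κα + κ/2 − 3 = 0` of the tilted drift), THEN the normalised tilted measure
`Q̄_A = (Y_∞ / Φ_A′(0)^α) · P` is a probability measure under which `Mⁿ/√κ` carries the martingale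
clock `cⁿ` (`Process.HasMartingaleClock`) — the input of the Dambis–Dubins–Schwarz step
`HasMartingaleClock.timeChange` / `isBrownianReal_concat`, as in `exists_sle_image_brownian`.
[cite: LawlerSchrammWerner2003Restriction, Prop. 5.3 with §5 (5.1)–(5.3)] -/
theorem hasMartingaleClock_imgMartK_tilted :
    ∀ (κ : ℝ≥0) (hκ0 : 0 < κ) (hκ : κ ≤ 8 / 3) (A : Set ℂ) (hA : IsStarHull A) (hne : A.Nonempty)
      (Φ : ConformalEquiv (upperHalfPlaneSet \ A) upperHalfPlaneSet), IsRestrictionMap A Φ →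
      ∀ (d : ℝ), HasRestrictionDeriv A Φ d → ∀ (Y : ℝ≥0 → (ℝ≥0 → ℝ) → ℝ),
        IsRestrictionMartingaleK κ (sleBubbleExponent κ) (sleBubbleIntensityReal κ) A (LpK κ A) Y → ∀ (n : ℕ),
        Martingale (fun t ω => imgMartK κ hA hne n t ω * Y t ω) brownianFiltration preWienerMeasure →
        Martingale (fun t ω => (imgMartK κ hA hne n t ω ^ 2 - κ * imgClockK κ hA hne n t ω) * Y t ω)
          brownianFiltration preWienerMeasure →
        IsProbabilityMeasure (preWienerMeasure.withDensity fun ω =>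
            ENNReal.ofReal ((d ^ sleBubbleExponent κ)⁻¹ * Yinf Y ω)) ∧
          ∃ N : ℝ, Literature.Probability.Process.HasMartingaleClock
            (fun t ω => (Real.sqrt κ)⁻¹ * imgMartK κ hA hne n t ω) (imgClockK κ hA hne n) brownianFiltration
            (preWienerMeasure.withDensity fun ω => ENNReal.ofReal ((d ^ sleBubbleExponent κ)⁻¹ * Yinf Y ω)) N := by
  intro κ hκ0 hκ A hA hne Φ hΦ d hd Y hY n hMY hM2Y
  haveI := isProbabilityMeasure_preWienerMeasure'
  set α : ℝ := sleBubbleExponent κ with hαdef'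
  set lam : ℝ := sleBubbleIntensityReal κ with hlamdef'
  have hαdef : α = (6 - κ) / (2 * κ) := rfl
  have hlamdef : lam = (8 - 3 * κ) * (6 - κ) / (2 * κ) := rfl
  obtain ⟨hαpos, -⟩ := exponents_pos hκ hαdef hlamdef hκ0
  have hκ4 : κ ≤ 4 := hκ.trans (by rw [div_le_iff₀ (by norm_num : (0 : ℝ≥0) < 3)]; norm_num)
  have huniq : IsStarHull.existsUnique_isRestrictionMap := IsStarHull.existsUnique_isRestrictionMap_holds
  have h62 := sle_restrictionDeriv_frequently_gtK_of_isStarHull hκ0 hκ4 hA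
  have hdpos : 0 < d := HasRestrictionDeriv.pos IsStarHull.exists_hasRestrictionDeriv_holds hA hΦ hd
  set m : ℝ := d ^ α with hm
  have hm0 : 0 < m := Real.rpow_pos_of_pos hdpos _
  -- the normalised density process `Y / m` and its terminal value
  set Y' : ℝ≥0 → (ℝ≥0 → ℝ) → ℝ := fun t ω ↦ m⁻¹ * Y t ω with hY'
  set Yi : (ℝ≥0 → ℝ) → ℝ := fun ω ↦ m⁻¹ * Yinf Y ω with hYi
  have hY'mart : Martingale Y' brownianFiltration preWienerMeasure := hY.martingale.smul m⁻¹
  have hY'b : ∀ t ω, |Y' t ω| ≤ m⁻¹ := fun t ω ↦ by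
    have h := hY.mem_Icc t ω
    rw [hY', abs_mul, abs_of_pos (inv_pos.2 hm0), abs_of_nonneg h.1]
    exact mul_le_of_le_one_right (inv_pos.2 hm0).le h.2
  have hlim' : ∀ᵐ ω ∂preWienerMeasure, Tendsto (fun k : ℕ ↦ Y' k ω) atTop (𝓝 (Yi ω)) := by
    filter_upwards [ae_tendsto_nat_Yinf hA hY] with ω hω
    exact hω.const_mul _
  have hYim : Measurable Yi := hY.measurable_Yinf.const_mul _
  have hYi0 : ∀ ω, 0 ≤ Yi ω := fun ω ↦ mul_nonneg (inv_pos.2 hm0).le (hY.Yinf_mem_Icc ω).1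
  -- the process `Mⁿ/√κ` and the clock
  have hsκ : (0 : ℝ) < Real.sqrt κ := Real.sqrt_pos.2 (by exact_mod_cast hκ0)
  have hκne : ((κ : ℝ≥0) : ℝ) ≠ 0 := by exact_mod_cast hκ0.ne'
  obtain ⟨N', -, hN'⟩ := exists_forall_abs_imgMartK_le (κ := κ) hA hne n
  set M := imgMartK κ hA hne n with hMdef
  set c := imgClockK κ hA hne n with hcdef
  set X : ℝ≥0 → (ℝ≥0 → ℝ) → ℝ := fun t ω ↦ (Real.sqrt κ)⁻¹ * M t ω with hXdef
  have hX : StronglyAdapted brownianFiltration X := fun t ↦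
    ((stronglyAdapted_imgMartK (κ := κ) (hA := hA) (hne := hne) n) t).const_mul _
  have hc : Adapted brownianFiltration c := adapted_imgClockK n
  have hXb : ∀ t ω, |X t ω| ≤ (Real.sqrt κ)⁻¹ * N' := fun t ω ↦ by
    rw [hXdef, abs_mul, abs_of_pos (inv_pos.2 hsκ)]
    exact mul_le_mul_of_nonneg_left (hN' t ω) (inv_pos.2 hsκ).le
  have hc0 : ∀ ω, c 0 ω = 0 := fun ω ↦ imgClockK_zero n ω
  have hcmono : ∀ ω ⦃s t : ℝ≥0⦄, s ≤ t → c s ω ≤ c t ω := fun ω s t hst ↦ imgClockK_mono n ω hst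
  have hcsub : ∀ ω ⦃s t : ℝ≥0⦄, s ≤ t → c t ω - c s ω ≤ (t : ℝ) - s := fun ω s t hst ↦ imgClockK_sub_le hst ω
  -- the two tilted martingale identities, rescaled
  have hXY : Martingale (fun t ω ↦ X t ω * Y' t ω) brownianFiltration preWienerMeasure := by
    have e : (fun t ω ↦ X t ω * Y' t ω) = ((Real.sqrt κ)⁻¹ * m⁻¹) • fun t ω ↦ M t ω * Y t ω := by
      funext t ω
      simp only [hXdef, hY', Pi.smul_apply, smul_eq_mul]
      ring
    rw [e]; exact hMY.smul _
  have hX2Y : Martingale (fun t ω ↦ (X t ω ^ 2 - c t ω) * Y' t ω) brownianFiltration preWienerMeasure := by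
    have hsq : ((Real.sqrt κ)⁻¹) ^ 2 = ((κ : ℝ≥0) : ℝ)⁻¹ := by
      rw [inv_pow, Real.sq_sqrt (NNReal.coe_nonneg κ)]
    have e : (fun t ω ↦ (X t ω ^ 2 - c t ω) * Y' t ω) =
        (((κ : ℝ≥0) : ℝ)⁻¹ * m⁻¹) • fun t ω ↦ (M t ω ^ 2 - κ * c t ω) * Y t ω := by
      funext t ω
      simp only [hXdef, hY', Pi.smul_apply, smul_eq_mul]
      rw [mul_pow, hsq]
      field_simp
    rw [e]; exact hM2Y.smul _
  -- total mass one
  have hone : ∫⁻ ω, ENNReal.ofReal (Yi ω) ∂preWienerMeasure = 1 := by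
    have e : (fun ω ↦ ENNReal.ofReal (Yi ω)) = fun ω ↦ ENNReal.ofReal m⁻¹ * ENNReal.ofReal (Yinf Y ω) := by
      funext ω; rw [hYi]; exact ENNReal.ofReal_mul (inv_pos.2 hm0).le
    rw [e, lintegral_const_mul _ hY.measurable_Yinf.ennreal_ofReal,
      hY.lintegral_ofReal_Yinf_eq hαpos huniq hA hΦ hd h62, ← ENNReal.ofReal_mul (inv_pos.2 hm0).le,
      inv_mul_cancel₀ hm0.ne', ENNReal.ofReal_one]
  exact ⟨isProbabilityMeasure_withDensity_of_lintegral_eq_one hone, (Real.sqrt κ)⁻¹ * N',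
    hasMartingaleClock_withDensity hY'mart hY'b hlim' hYim hYi0 hX hc hXb hc0 hcmono hcsub hXY hX2Y⟩

end SLE

end Summit.CriticalPhenomena.SAWScalingLimit.Theorems.SubseqIdentification.BoundaryAreaLaw

end
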